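import Mathlib
import HarnessLib
import Summits.ValiantsHypothesis.ValiantsHypothesis.Theorems.KPlusLogSqLawWeakLiftingTowerGraftWronskianKFourAlternating

/-!
# Tower graft line — CONJECTURE W AT `K = 4`: POSITIVE LEVELS ARE SIMPLE (where the fifth zero cannot be)

Helper file for LINE (B) `Cruxes/WeakLifting/Lines/tower_graft.lean` (crux `WeakLifting` = stmt-ValiantsHypothesis-19561), continuing
hands g9/g10 on CONJECTURE W «`Z₊(W(u,v)) ≤ 2K − 4`» (the `k = 1` developable conjecture of [cite: SedykhShapiro2005] on lacunary
moment arcs).  NO stub is claimed.  The tree already holds the `K = 4` NORMAL FORM of a would-be counterexample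
(`…WronskianKFourAlternating.plucker_alternating_of_five_le`: on the orientation `d₀ + d₃ < d₁ + d₂`, five positive zeros force the
fully alternating Plücker pattern `p₀₁p₀₂ < 0, p₀₂p₀₃ < 0, p₀₃p₁₂ < 0, p₁₂p₁₃ < 0, p₁₃p₂₃ < 0`).  This file proves, ON THAT CELL, the
first analytic step of the exclusion of the fifth zero:

* the two distinguished members of the plane `L = span(u,v)` that omit the monomial `X^{d₁}` resp. `X^{d₂}`,
  `U₁ = Σₗ p_{l1} X^{dₗ} = v₁·u − u₁·v` and `U₂ = Σₗ p_{l2} X^{dₗ} = v₂·u − u₂·v` (`p_{ab} = uₐv_b − u_b vₐ`), have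
  `W(U₁,U₂) = p₁₂ · W(u,v)` (`wronskian_special_members`), so the same positive zeros;
* ★ `countP_posRoots_level_le_one_of_nonneg` — for every level `c ≥ 0` the member `U₂ − c·U₁` has coefficient signs `(+,+,+,−)·sgn p₁₂`
  on `X^{d₀}, X^{d₁}, X^{d₂}, X^{d₃}`, hence AT MOST ONE positive root COUNTED WITH MULTIPLICITY (Descartes, Mathlib
  `roots_countP_pos_le_signVariations` + the tree's `Census.signVariations_rsum_le_changes`); likewise `U₁` and `U₂` themselves
  (`countP_posRoots_special_one_le_one`, `countP_posRoots_special_two_le_one`);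
* ★★ `wronskian_root_special_product_neg` — THE LOCALIZATION: if `x > 0` and `W(u,v)(x) = 0` then `U₁(x)·U₂(x) < 0`, or `x` is a
  common zero of `U₁` and `U₂`.  Proof: with `c = U₂(x)/U₁(x)` the member `U₂ − c·U₁` has a DOUBLE root at `x` (its derivative there is
  `W(U₁,U₂)(x)/U₁(x) = 0`), impossible for `c ≥ 0`; and a zero of `W` at the (simple) root of `U₁` forces `U₂(x) = 0`.

Why this matters (memo `evidence-g11-conjectureW-K4-levels.md` on the item carries the full paper argument): all positive zeros of
`W` are critical points of the quotient `h = U₂/U₁` at NEGATIVE levels, the level polynomials `U₂ − c·U₁` have `≤ 3` positive roots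
with multiplicity with a banded Descartes table (`1 / 2 / 3` by level), so `h` has at most `3` local extrema off its pole, and the
multiplicity budget `5` of the six-nomial `X·W` then leaves at most `4` DISTINCT positive zeros — Conjecture W at `K = 4`
(= «Theorem A for lacunary arcs»), whose topological half (IVT / lap counting) is NOT formalised here.  HONEST FRAMING: nothing on
S4/S4f/S5/S5ᴸ, TowerB, `WeakLifting`, Conjecture B, `MatrixDescartes` (18050), `VP ≠ VNP`.  Def-free.  Seat: prover
leafhand-val-kpluslogsqlaw-1 g11, `--supports stmt-ValiantsHypothesis-19561 --as helper`.
[folklore: Descartes' rule of signs with multiplicity (Mathlib); the localization is this work]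
-/

-- `Summit.ValiantsHypothesis.ValiantsHypothesis.…` repeats a component by the D-0017 layout
-- (single-conjunct summit), which the `dupNamespace` linter flags; the name is mandated.
set_option linter.dupNamespace false
set_option autoImplicit false

namespace Summit.ValiantsHypothesis.ValiantsHypothesis.Theorems.KPlusLogSqLaw.TowerGraft

open Polynomial Finset
open scoped BigOperators Polynomial
open Summit.ValiantsHypothesis.ValiantsHypothesis.Theorems.LacunarySymmetroidMatrixDescartes.Census
  (signVariations_rsum_le_changes mul_pos_of_mul_neg_of_mul_neg mul_neg_of_mul_pos_of_mul_neg)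

namespace WronskianDevelopable

/-! ## §1 Four-term fewnomials: coefficients, range form, Descartes against one sign change -/

/-- a strictly increasing extension to `ℕ` of a strictly increasing `d : Fin 4 → ℕ`. [folklore] -/
theorem exists_strictMono_ext_four (d : Fin 4 → ℕ) (hd : StrictMono d) :
    ∃ e : ℕ → ℕ, StrictMono e ∧ e 0 = d 0 ∧ e 1 = d 1 ∧ e 2 = d 2 ∧ e 3 = d 3 := by
  have h01 : d 0 < d 1 := hd (by decide)
  have h12 : d 1 < d 2 := hd (by decide)
  have h23 : d 2 < d 3 := hd (by decide)
  refine ⟨fun t => if t = 0 then d 0 else if t = 1 then d 1 else if t = 2 then d 2 else d 3 + (t - 3), ?_,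
    by simp, by simp, by simp, by simp⟩
  refine strictMono_nat_of_lt_succ fun t => ?_
  rcases Nat.lt_or_ge t 3 with ht | ht
  · interval_cases t <;> simp <;> omega
  · have h1 : t ≠ 0 := by omega
    have h2 : t ≠ 1 := by omega
    have h3 : t ≠ 2 := by omega
    have h6 : t + 1 ≠ 0 := by omega
    have h7 : t + 1 ≠ 1 := by omega
    have h8 : t + 1 ≠ 2 := by omega
    simp only [h1, h2, h3, h6, h7, h8, if_false]
    omega

/-- a `Fin 4` fewnomial as a `range 4` sum along such an extension. [folklore] -/
theorem fewnomial_four_eq_rsum (w : Fin 4 → ℝ) (d : Fin 4 → ℕ) (e : ℕ → ℕ)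
    (he0 : e 0 = d 0) (he1 : e 1 = d 1) (he2 : e 2 = d 2) (he3 : e 3 = d 3) :
    (∑ l, C (w l) * (X : ℝ[X]) ^ d l) =
      ∑ t ∈ range 4, C ((fun t : ℕ => if t = 0 then w 0 else if t = 1 then w 1 else if t = 2 then w 2
        else if t = 3 then w 3 else 0) t) * X ^ (e t) := by
  simp only [Fin.sum_univ_four, Finset.sum_range_succ, Finset.sum_range_zero, zero_add]
  simp only [he0, he1, he2, he3]
  norm_num

/-- the coefficient of a fewnomial on a strictly increasing support at its `k`-th exponent. [folklore] -/
theorem coeff_fewnomial_four (w : Fin 4 → ℝ) (d : Fin 4 → ℕ) (hd : StrictMono d) (k : Fin 4) :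
    (∑ l, C (w l) * (X : ℝ[X]) ^ d l).coeff (d k) = w k := by
  rw [finsetSum_coeff]
  simp only [coeff_C_mul, coeff_X_pow]
  rw [Finset.sum_eq_single k]
  · simp
  · intro l _ hl
    have : d k ≠ d l := fun h => hl (hd.injective h).symm
    simp [this]
  · intro h; exact absurd (Finset.mem_univ k) h

/-- scaling a fewnomial scales its coefficients. [folklore] -/
theorem C_mul_fewnomial_four (s : ℝ) (w : Fin 4 → ℝ) (d : Fin 4 → ℕ) :
    C s * (∑ l, C (w l) * (X : ℝ[X]) ^ d l) = ∑ l, C (s * w l) * (X : ℝ[X]) ^ d l := by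
  rw [Finset.mul_sum]
  refine Finset.sum_congr rfl fun l _ => ?_
  rw [map_mul, mul_assoc]

/-- **Descartes with multiplicity against the weak pattern `(+,+,+,−)`**: coefficients `w₀, w₁, w₂ ≥ 0 ≥ w₃` on a strictly
increasing support give at most ONE positive root counted with multiplicity. [folklore] -/
theorem countP_posRoots_fewnomial_four_le_one (w : Fin 4 → ℝ) (d : Fin 4 → ℕ) (hd : StrictMono d)
    (h0 : 0 ≤ w 0) (h1 : 0 ≤ w 1) (h2 : 0 ≤ w 2) (h3 : w 3 ≤ 0) :
    (∑ l, C (w l) * (X : ℝ[X]) ^ d l).roots.countP (fun x => 0 < x) ≤ 1 := by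
  obtain ⟨e, he, he0, he1, he2, he3⟩ := exists_strictMono_ext_four d hd
  rw [fewnomial_four_eq_rsum w d e he0 he1 he2 he3]
  set c : ℕ → ℝ := fun t : ℕ => if t = 0 then w 0 else if t = 1 then w 1 else if t = 2 then w 2
    else if t = 3 then w 3 else 0 with hc
  refine (Polynomial.roots_countP_pos_le_signVariations _).trans ?_
  have h := signVariations_rsum_le_changes 4 e he c (fun t => decide (t < 3))
    (fun t _ htt => by
      have ht3 : t < 3 := of_decide_eq_true htt
      interval_cases t <;> simp [hc, h0, h1, h2])
    (fun t ht htt => by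
      have ht3 : ¬ t < 3 := of_decide_eq_false htt
      have ht' : t = 3 := by omega
      subst ht'; simp [hc, h3])
  refine h.trans ?_
  simp [Finset.sum_range_succ]

/-- the same against the pattern `(−,−,−,+)`. [folklore] -/
theorem countP_posRoots_fewnomial_four_le_one' (w : Fin 4 → ℝ) (d : Fin 4 → ℕ) (hd : StrictMono d)
    (h0 : w 0 ≤ 0) (h1 : w 1 ≤ 0) (h2 : w 2 ≤ 0) (h3 : 0 ≤ w 3) :
    (∑ l, C (w l) * (X : ℝ[X]) ^ d l).roots.countP (fun x => 0 < x) ≤ 1 := by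
  have hneg : (∑ l, C ((-1) * w l) * (X : ℝ[X]) ^ d l).roots = (∑ l, C (w l) * (X : ℝ[X]) ^ d l).roots := by
    rw [← C_mul_fewnomial_four, roots_C_mul _ (by norm_num)]
  rw [← hneg]
  exact countP_posRoots_fewnomial_four_le_one _ d hd (by linarith) (by linarith) (by linarith) (by linarith)

/-- with a nonzero scale of known sign: if `s ≠ 0` and `s·w` has the pattern `(+,+,+,−)`, at most one positive root with
multiplicity. [folklore] -/
theorem countP_posRoots_fewnomial_four_le_one_of_scale (s : ℝ) (hs : s ≠ 0) (w : Fin 4 → ℝ) (d : Fin 4 → ℕ)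
    (hd : StrictMono d) (h0 : 0 ≤ s * w 0) (h1 : 0 ≤ s * w 1) (h2 : 0 ≤ s * w 2) (h3 : s * w 3 ≤ 0) :
    (∑ l, C (w l) * (X : ℝ[X]) ^ d l).roots.countP (fun x => 0 < x) ≤ 1 := by
  have hsc : (∑ l, C (s * w l) * (X : ℝ[X]) ^ d l).roots = (∑ l, C (w l) * (X : ℝ[X]) ^ d l).roots := by
    rw [← C_mul_fewnomial_four, roots_C_mul _ hs]
  rw [← hsc]
  exact countP_posRoots_fewnomial_four_le_one (fun l => s * w l) d hd h0 h1 h2 h3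

/-- a double root at a positive point costs two in the multiplicity count. [folklore] -/
theorem two_le_countP_posRoots_of_double_root (f : ℝ[X]) (hf : f ≠ 0) {x : ℝ} (hx : 0 < x)
    (h0 : f.eval x = 0) (h1 : (derivative f).eval x = 0) : 2 ≤ f.roots.countP (fun y => 0 < y) := by
  classical
  have hmult : 1 < f.rootMultiplicity x := (one_lt_rootMultiplicity_iff_isRoot hf).mpr ⟨h0, h1⟩
  have hcount : 2 ≤ f.roots.count x := by rw [count_roots]; omega
  have hrep : Multiset.replicate 2 x ≤ f.roots := Multiset.le_count_iff_replicate_le.mp hcount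
  have hrc : (Multiset.replicate 2 x).countP (fun y => 0 < y) = 2 := by
    rw [Multiset.countP_eq_card_filter, Multiset.filter_eq_self.mpr (fun y hy => ?_)]
    · simp
    · rw [Multiset.eq_of_mem_replicate hy]; exact hx
  calc 2 = (Multiset.replicate 2 x).countP (fun y => 0 < y) := hrc.symm
    _ ≤ f.roots.countP (fun y => 0 < y) := Multiset.countP_le_of_le _ hrep

/-! ## §2 The two distinguished members of the plane and their Wronskian -/

/-- the member `v_k·u − u_k·v` of the pencil omits the monomial `X^{d_k}`: its coefficients are the Plücker column `p_{lk} = uₗv_k − u_k vₗ`.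
[folklore] -/
theorem special_member_eq (u v : Fin 4 → ℝ) (d : Fin 4 → ℕ) (k : Fin 4) :
    C (v k) * (∑ l, C (u l) * (X : ℝ[X]) ^ d l) + C (-(u k)) * (∑ l, C (v l) * (X : ℝ[X]) ^ d l) =
      ∑ l, C (u l * v k - u k * v l) * (X : ℝ[X]) ^ d l := by
  rw [pencil_fewnomial_eq]
  refine Finset.sum_congr rfl fun l _ => ?_
  congr 2
  ring

/-- **`W(U₁, U₂) = p₁₂ · W(u,v)`** for `U₁ = v₁u − u₁v`, `U₂ = v₂u − u₂v`: the two distinguished members span the same plane when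
`p₁₂ ≠ 0`, so their Wronskian has the same zeros. [folklore] -/
theorem wronskian_special_members (u v : Fin 4 → ℝ) (d : Fin 4 → ℕ) :
    wronskian (∑ l, C (u l * v 1 - u 1 * v l) * (X : ℝ[X]) ^ d l) (∑ l, C (u l * v 2 - u 2 * v l) * (X : ℝ[X]) ^ d l) =
      C (u 1 * v 2 - u 2 * v 1) * wronskian (∑ l, C (u l) * (X : ℝ[X]) ^ d l) (∑ l, C (v l) * (X : ℝ[X]) ^ d l) := by
  rw [← special_member_eq u v d 1, ← special_member_eq u v d 2, wronskian_pencil_pencil]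
  congr 2
  ring

/-- the level member `U₂ − c·U₁` as a fewnomial on the same support. [folklore] -/
theorem level_member_eq (u v : Fin 4 → ℝ) (d : Fin 4 → ℕ) (c : ℝ) :
    (∑ l, C (u l * v 2 - u 2 * v l) * (X : ℝ[X]) ^ d l) - C c * (∑ l, C (u l * v 1 - u 1 * v l) * (X : ℝ[X]) ^ d l) =
      ∑ l, C ((u l * v 2 - u 2 * v l) - c * (u l * v 1 - u 1 * v l)) * (X : ℝ[X]) ^ d l := by
  rw [Finset.mul_sum, ← Finset.sum_sub_distrib]
  refine Finset.sum_congr rfl fun l _ => ?_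
  simp only [map_sub, map_mul]
  ring

/-! ## §3 Descartes on the fully alternating cell: the level members, `U₁`, `U₂` -/

section Cell

variable (u v : Fin 4 → ℝ) (d : Fin 4 → ℕ)

/-- sign bookkeeping on the fully alternating cell: `p₀₁p₁₂ < 0`, `0 < p₀₂p₁₂`, `0 < p₁₂p₂₃` (and `p₁₂ ≠ 0`). [this work] -/
theorem cell_signs
    (h1 : (u 0 * v 1 - u 1 * v 0) * (u 0 * v 2 - u 2 * v 0) < 0) (h2 : (u 0 * v 2 - u 2 * v 0) * (u 0 * v 3 - u 3 * v 0) < 0)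
    (h3 : (u 0 * v 3 - u 3 * v 0) * (u 1 * v 2 - u 2 * v 1) < 0) (h4 : (u 1 * v 2 - u 2 * v 1) * (u 1 * v 3 - u 3 * v 1) < 0)
    (h5 : (u 1 * v 3 - u 3 * v 1) * (u 2 * v 3 - u 3 * v 2) < 0) :
    (u 0 * v 1 - u 1 * v 0) * (u 1 * v 2 - u 2 * v 1) < 0 ∧ 0 < (u 0 * v 2 - u 2 * v 0) * (u 1 * v 2 - u 2 * v 1) ∧
      0 < (u 1 * v 2 - u 2 * v 1) * (u 2 * v 3 - u 3 * v 2) ∧ (u 1 * v 2 - u 2 * v 1) ≠ 0 := by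
  have h13 : 0 < (u 0 * v 1 - u 1 * v 0) * (u 0 * v 3 - u 3 * v 0) := mul_pos_of_mul_neg_of_mul_neg h1 h2
  have h1_12 : (u 0 * v 1 - u 1 * v 0) * (u 1 * v 2 - u 2 * v 1) < 0 := mul_neg_of_mul_pos_of_mul_neg h13 h3
  have h2_12 : 0 < (u 0 * v 2 - u 2 * v 0) * (u 1 * v 2 - u 2 * v 1) := by
    have h' : (u 0 * v 2 - u 2 * v 0) * (u 0 * v 1 - u 1 * v 0) < 0 := by rw [mul_comm]; exact h1
    exact mul_pos_of_mul_neg_of_mul_neg h' h1_12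
  have h12_23 : 0 < (u 1 * v 2 - u 2 * v 1) * (u 2 * v 3 - u 3 * v 2) := mul_pos_of_mul_neg_of_mul_neg h4 h5
  have hne : (u 1 * v 2 - u 2 * v 1) ≠ 0 := by
    intro h; rw [h, zero_mul] at h4; exact lt_irrefl 0 h4
  exact ⟨h1_12, h2_12, h12_23, hne⟩

/-- ★ **positive levels are simple**: on the fully alternating cell, for every `c ≥ 0` the member `U₂ − c·U₁` has at most ONE
positive root counted with multiplicity (coefficient signs `sgn p₁₂ · (+,+,+,−)`). [this work] -/
theorem countP_posRoots_level_le_one_of_nonneg (hd : StrictMono d)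
    (h1 : (u 0 * v 1 - u 1 * v 0) * (u 0 * v 2 - u 2 * v 0) < 0) (h2 : (u 0 * v 2 - u 2 * v 0) * (u 0 * v 3 - u 3 * v 0) < 0)
    (h3 : (u 0 * v 3 - u 3 * v 0) * (u 1 * v 2 - u 2 * v 1) < 0) (h4 : (u 1 * v 2 - u 2 * v 1) * (u 1 * v 3 - u 3 * v 1) < 0)
    (h5 : (u 1 * v 3 - u 3 * v 1) * (u 2 * v 3 - u 3 * v 2) < 0) {c : ℝ} (hc : 0 ≤ c) :
    (∑ l, C ((u l * v 2 - u 2 * v l) - c * (u l * v 1 - u 1 * v l)) * (X : ℝ[X]) ^ d l).roots.countP (fun x => 0 < x) ≤ 1 := by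
  obtain ⟨hA, hB, hC, hne⟩ := cell_signs u v h1 h2 h3 h4 h5
  refine countP_posRoots_fewnomial_four_le_one_of_scale (u 1 * v 2 - u 2 * v 1) hne _ d hd ?_ ?_ ?_ ?_
  · -- `X^{d₀}`: `p₁₂ (p₀₂ − c p₀₁) = p₀₂p₁₂ − c·p₀₁p₁₂ ≥ 0`
    have e : (u 1 * v 2 - u 2 * v 1) * ((u 0 * v 2 - u 2 * v 0) - c * (u 0 * v 1 - u 1 * v 0)) =
        (u 0 * v 2 - u 2 * v 0) * (u 1 * v 2 - u 2 * v 1) - c * ((u 0 * v 1 - u 1 * v 0) * (u 1 * v 2 - u 2 * v 1)) := by ring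
    rw [e]; nlinarith [mul_nonneg hc (le_of_lt (neg_pos.mpr hA))]
  · -- `X^{d₁}`: `p₁₂ · p₁₂ ≥ 0`
    have e : (u 1 * v 2 - u 2 * v 1) * ((u 1 * v 2 - u 2 * v 1) - c * (u 1 * v 1 - u 1 * v 1)) =
        (u 1 * v 2 - u 2 * v 1) * (u 1 * v 2 - u 2 * v 1) := by ring
    rw [e]; exact mul_self_nonneg _
  · -- `X^{d₂}`: `c · p₁₂² ≥ 0`
    have e : (u 1 * v 2 - u 2 * v 1) * ((u 2 * v 2 - u 2 * v 2) - c * (u 2 * v 1 - u 1 * v 2)) =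
        c * ((u 1 * v 2 - u 2 * v 1) * (u 1 * v 2 - u 2 * v 1)) := by ring
    rw [e]; exact mul_nonneg hc (mul_self_nonneg _)
  · -- `X^{d₃}`: `−p₁₂p₂₃ + c·p₁₂p₁₃ ≤ 0`
    have e : (u 1 * v 2 - u 2 * v 1) * ((u 3 * v 2 - u 2 * v 3) - c * (u 3 * v 1 - u 1 * v 3)) =
        -((u 1 * v 2 - u 2 * v 1) * (u 2 * v 3 - u 3 * v 2)) + c * ((u 1 * v 2 - u 2 * v 1) * (u 1 * v 3 - u 3 * v 1)) := by ring
    rw [e]; nlinarith [mul_nonneg hc (le_of_lt (neg_pos.mpr h4))]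

/-- `U₁ = Σ p_{l1} X^{dₗ}` has at most one positive root with multiplicity (signs `sgn p₁₂ · (−,0,−,+)`). [this work] -/
theorem countP_posRoots_special_one_le_one (hd : StrictMono d)
    (h1 : (u 0 * v 1 - u 1 * v 0) * (u 0 * v 2 - u 2 * v 0) < 0) (h2 : (u 0 * v 2 - u 2 * v 0) * (u 0 * v 3 - u 3 * v 0) < 0)
    (h3 : (u 0 * v 3 - u 3 * v 0) * (u 1 * v 2 - u 2 * v 1) < 0) (h4 : (u 1 * v 2 - u 2 * v 1) * (u 1 * v 3 - u 3 * v 1) < 0)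
    (h5 : (u 1 * v 3 - u 3 * v 1) * (u 2 * v 3 - u 3 * v 2) < 0) :
    (∑ l, C (u l * v 1 - u 1 * v l) * (X : ℝ[X]) ^ d l).roots.countP (fun x => 0 < x) ≤ 1 := by
  obtain ⟨hA, hB, hC, hne⟩ := cell_signs u v h1 h2 h3 h4 h5
  have hne' : -(u 1 * v 2 - u 2 * v 1) ≠ 0 := neg_ne_zero.mpr hne
  refine countP_posRoots_fewnomial_four_le_one_of_scale (-(u 1 * v 2 - u 2 * v 1)) hne' _ d hd ?_ ?_ ?_ ?_
  · have e : -(u 1 * v 2 - u 2 * v 1) * (u 0 * v 1 - u 1 * v 0) = -((u 0 * v 1 - u 1 * v 0) * (u 1 * v 2 - u 2 * v 1)) := by ring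
    rw [e]; linarith
  · have e : -(u 1 * v 2 - u 2 * v 1) * (u 1 * v 1 - u 1 * v 1) = 0 := by ring
    rw [e]
  · have e : -(u 1 * v 2 - u 2 * v 1) * (u 2 * v 1 - u 1 * v 2) = (u 1 * v 2 - u 2 * v 1) * (u 1 * v 2 - u 2 * v 1) := by ring
    rw [e]; exact mul_self_nonneg _
  · have e : -(u 1 * v 2 - u 2 * v 1) * (u 3 * v 1 - u 1 * v 3) = (u 1 * v 2 - u 2 * v 1) * (u 1 * v 3 - u 3 * v 1) := by ring
    rw [e]; exact h4.le

/-- `U₂ = Σ p_{l2} X^{dₗ}` has at most one positive root with multiplicity (signs `sgn p₁₂ · (+,+,0,−)`; the level `c = 0`). [this work] -/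
theorem countP_posRoots_special_two_le_one (hd : StrictMono d)
    (h1 : (u 0 * v 1 - u 1 * v 0) * (u 0 * v 2 - u 2 * v 0) < 0) (h2 : (u 0 * v 2 - u 2 * v 0) * (u 0 * v 3 - u 3 * v 0) < 0)
    (h3 : (u 0 * v 3 - u 3 * v 0) * (u 1 * v 2 - u 2 * v 1) < 0) (h4 : (u 1 * v 2 - u 2 * v 1) * (u 1 * v 3 - u 3 * v 1) < 0)
    (h5 : (u 1 * v 3 - u 3 * v 1) * (u 2 * v 3 - u 3 * v 2) < 0) :
    (∑ l, C (u l * v 2 - u 2 * v l) * (X : ℝ[X]) ^ d l).roots.countP (fun x => 0 < x) ≤ 1 := by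
  have h := countP_posRoots_level_le_one_of_nonneg u v d hd h1 h2 h3 h4 h5 (le_refl (0 : ℝ))
  simpa using h

end Cell

/-! ## §4 The localization of the positive zeros of `W(u,v)` -/

/-- ★★ **LOCALIZATION ON THE FULLY ALTERNATING CELL.**  If `d` is strictly increasing, the Plücker coordinates of `(u,v)` have the
fully alternating pattern (`p₀₁p₀₂, p₀₂p₀₃, p₀₃p₁₂, p₁₂p₁₃, p₁₃p₂₃ < 0` — forced by five positive zeros on the orientation
`d₀ + d₃ < d₁ + d₂`, `plucker_alternating_of_five_le`), and `x > 0` is a zero of `W(u,v)`, then the two distinguished members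
`U₁ = v₁u − u₁v`, `U₂ = v₂u − u₂v` satisfy `U₁(x)·U₂(x) < 0`, unless `x` is a common zero of both.  Equivalently: every positive zero
of the Wronskian is a critical point of `U₂/U₁` at a NEGATIVE level (positive levels `U₂ − c U₁`, `c ≥ 0`, are simple). [this work] -/
theorem wronskian_root_special_product_neg (u v : Fin 4 → ℝ) (d : Fin 4 → ℕ) (hd : StrictMono d)
    (h1 : (u 0 * v 1 - u 1 * v 0) * (u 0 * v 2 - u 2 * v 0) < 0) (h2 : (u 0 * v 2 - u 2 * v 0) * (u 0 * v 3 - u 3 * v 0) < 0)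
    (h3 : (u 0 * v 3 - u 3 * v 0) * (u 1 * v 2 - u 2 * v 1) < 0) (h4 : (u 1 * v 2 - u 2 * v 1) * (u 1 * v 3 - u 3 * v 1) < 0)
    (h5 : (u 1 * v 3 - u 3 * v 1) * (u 2 * v 3 - u 3 * v 2) < 0) {x : ℝ} (hx : 0 < x)
    (hW : (wronskian (∑ l, C (u l) * (X : ℝ[X]) ^ d l) (∑ l, C (v l) * (X : ℝ[X]) ^ d l)).eval x = 0) :
    (∑ l, C (u l * v 1 - u 1 * v l) * (X : ℝ[X]) ^ d l).eval x *
        (∑ l, C (u l * v 2 - u 2 * v l) * (X : ℝ[X]) ^ d l).eval x < 0 ∨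
      ((∑ l, C (u l * v 1 - u 1 * v l) * (X : ℝ[X]) ^ d l).eval x = 0 ∧
        (∑ l, C (u l * v 2 - u 2 * v l) * (X : ℝ[X]) ^ d l).eval x = 0) := by
  obtain ⟨hA, hB, hC, hne⟩ := cell_signs u v h1 h2 h3 h4 h5
  set U₁ : ℝ[X] := ∑ l, C (u l * v 1 - u 1 * v l) * (X : ℝ[X]) ^ d l with hU₁
  set U₂ : ℝ[X] := ∑ l, C (u l * v 2 - u 2 * v l) * (X : ℝ[X]) ^ d l with hU₂
  -- the Wronskian of the distinguished members vanishes at `x` too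
  have hW12 : (wronskian U₁ U₂).eval x = 0 := by
    rw [hU₁, hU₂, wronskian_special_members, eval_mul, eval_C, hW, mul_zero]
  rw [InflectionLaw.eval_wronskian] at hW12
  by_cases hz : U₁.eval x = 0
  · -- at the root of `U₁`: it is simple, so `U₂(x) = 0`
    right
    refine ⟨hz, ?_⟩
    have hder : (derivative U₁).eval x ≠ 0 := by
      intro hd0
      have h2le := two_le_countP_posRoots_of_double_root U₁ ?_ hx hz hd0
      · have h1le := countP_posRoots_special_one_le_one u v d hd h1 h2 h3 h4 h5
        rw [← hU₁] at h1le
        omega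
      · -- `U₁ ≠ 0`: its `X^{d₂}` coefficient is `−p₁₂ ≠ 0`
        intro h0
        have hcoeff := coeff_fewnomial_four (fun l => u l * v 1 - u 1 * v l) d hd 2
        rw [← hU₁, h0, coeff_zero] at hcoeff
        apply hne; linarith
    rw [hz, zero_mul, zero_sub, neg_eq_zero] at hW12
    rcases mul_eq_zero.mp hW12 with h | h
    · exact absurd h hder
    · exact h
  · -- off the root of `U₁`: the level `c = U₂(x)/U₁(x)` has a double root at `x`, so `c < 0`
    left
    set c : ℝ := U₂.eval x / U₁.eval x with hc
    have hlevel : U₂ - C c * U₁ = ∑ l, C ((u l * v 2 - u 2 * v l) - c * (u l * v 1 - u 1 * v l)) * (X : ℝ[X]) ^ d l := by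
      rw [hU₁, hU₂]; exact level_member_eq u v d c
    have hf0 : (U₂ - C c * U₁).eval x = 0 := by
      rw [eval_sub, eval_mul, eval_C, hc, div_mul_cancel₀ _ hz, sub_self]
    have hf1 : (derivative (U₂ - C c * U₁)).eval x = 0 := by
      rw [derivative_sub, derivative_mul, derivative_C, zero_mul, zero_add, eval_sub, eval_mul, eval_C]
      -- `U₂'(x) = c · U₁'(x)` from `U₁ U₂' − U₁' U₂ = 0`
      have key : U₁.eval x * ((derivative U₂).eval x - c * (derivative U₁).eval x) = 0 := by
        rw [hc]
        field_simp
        linear_combination hW12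
      rcases mul_eq_zero.mp key with h | h
      · exact absurd h hz
      · exact h
    have hfne : U₂ - C c * U₁ ≠ 0 := by
      intro h0
      have hcoeff := coeff_fewnomial_four (fun l => (u l * v 2 - u 2 * v l) - c * (u l * v 1 - u 1 * v l)) d hd 1
      rw [← hlevel, h0, coeff_zero] at hcoeff
      apply hne
      have : (u 1 * v 2 - u 2 * v 1) - c * (u 1 * v 1 - u 1 * v 1) = u 1 * v 2 - u 2 * v 1 := by ring
      linarith [this]
    have h2le := two_le_countP_posRoots_of_double_root _ hfne hx hf0 hf1
    -- hence `c < 0`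
    have hcneg : c < 0 := by
      by_contra hcnn
      have h1le := countP_posRoots_level_le_one_of_nonneg u v d hd h1 h2 h3 h4 h5 (not_lt.mp hcnn)
      rw [← hlevel] at h1le
      omega
    -- and `U₁(x) U₂(x) = c · U₁(x)² < 0`
    have hsq : 0 < U₁.eval x * U₁.eval x := mul_self_pos.mpr hz
    have e : U₁.eval x * U₂.eval x = c * (U₁.eval x * U₁.eval x) := by
      rw [hc]; field_simp
    rw [e]
    exact mul_neg_of_neg_of_pos hcneg hsq

end WronskianDevelopable

end Summit.ValiantsHypothesis.ValiantsHypothesis.Theorems.KPlusLogSqLaw.TowerGraft
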